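import Mathlib
import Summits.NavierStokesRegularity.NavierStokesRegularity.Theorems.TaoLadderRungTwoBreakOneShiftWindowK1LinkD
import Summits.NavierStokesRegularity.NavierStokesRegularity.Theorems.TaylorModelRungThreeCertificateIntervalDEnclose
import HarnessLib

/-!
# The one-shift window system, XLVII: THE INSTANCE BRIDGE, generic part — the term data `RD` of the window field
# COMPUTED IN LEAN from an exact presentation of the table (`α = q · Λ^a`, `q ∈ ℚ`, `Λ = (1+ε₀)^{5/2}`), certified boxes
# of `Λ` and `Λ⁻¹`, tube-centre boxes and radii, a flat numbering and per-mode support lists; and its soundness: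
# `RowEnum` and `IsRTEncl` for the term list `wterms` of part XIX — the hypotheses `hRDc` / `hRD` of part XLVI
# `K1_of_grid` (cell harvest/h2-tao-ladder, seat p2; rung1/KERNEL-CHEAP-REPLAY-SPEC.md §8 (REAL-SIDE OBLIGATION OF THE
# INSTANCE), §9 (I); support for K1(1) = `NoSurvivingDSSOne`, stmt-NavierStokesRegularity-20205)

MODEL lattice ODEs only (Tao 2016 §4 normal form on Tao's shift set `S`); nothing here is a statement about
the Navier–Stokes equations; no item is closed; no instance is evaluated here.

* `TermPresD m` — the presentation: precision, window width `W`, flat size `n`, numbering `eN` with inverse `dN`,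
  per-mode support lists `supp i : List (Fin m × Fin m × S)` (`S` = Tao's shift set as a subtype), rational parts `qcoef` and `Λ`-exponents `apow` of the
  table, `ε₀ ∈ ℚ`, boxes `lam ∋ Λ`, `lamInv ∋ Λ⁻¹`, tube centre boxes `cen i k`, tube radii `rad k`;
* executable: `lamPow` (`Λ^p`, `p ∈ ℤ`), `coefBox`, `facD`, `termD`, `rowD`, **`mkRD`** (the `RRows` every step of
  the grid carries), `check` (the square certificates of `lam` / `lamInv`, exact rational arithmetic);
* `TermPresD.Frames F ε₀ α e` — what the instance proves about its frame (numbering values, table presentation,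
  support completeness, tube boxes);
* `rowEnum_wterms`, **`isRTEncl_wterms`**: `check ∧ Frames ⇒ IsRTEncl e (wterms(tube centres)) (wterms T t) rows mkRD`
  for EVERY tail realisation `T` in the tubes at time `t`; `IsRTEncl.of_val_eq` (transport along numberings with
  equal values — the per-step numberings `GridD.es`); `hRDc_of_frames` / `hRD_of_frames` (the two hypotheses of
  `K1_of_grid` verbatim, realisation `Tf u t = wterms (preclampTail u) t`, `hTf` = part XIX `wfieldFlat_eq_termField`).
-/

noncomputable section

-- the sub-problem namespace repeats the summit name by design (D-0017)
set_option linter.dupNamespace false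

namespace Summit.NavierStokesRegularity.NavierStokesRegularity.Theorems

namespace DSSOneShift

open Set Finset
open Literature.Analysis.FluidPDE Literature.Analysis.FluidPDE.TaoCascade
open Summit.NavierStokesRegularity.NavierStokesRegularity.Theorems.TaylorModelCert
open Summit.NavierStokesRegularity.NavierStokesRegularity.Theorems.CertificateGlueOn

/-! ### Dyadics as rationals -/

/-- A dyadic number as an exact rational. [folklore] -/
def Dyad.toRat (d : Dyad) : ℚ := (d.m : ℚ) * (2 : ℚ) ^ d.e

/-- Its real value is `toReal`. [folklore] -/
theorem Dyad.cast_toRat (d : Dyad) : ((Dyad.toRat d : ℚ) : ℝ) = d.toReal := by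
  simp [Dyad.toRat, Dyad.toReal]

/-- Tao's shift set as an index type (the `μ`-component of part XIX's term index `TIdx`). [cite: Tao2016AveragedNS, §4 after (4.1)] -/
abbrev ShiftIdx : Type := (shiftSet : Set (ℤ × ℤ × ℤ))

/-! ### The presentation -/

/-- **Exact presentation of a window field's term data.** [cite: Tao2016AveragedNS, §4 (4.1), (4.8); cell vocabulary, harvest/h2-tao-ladder rung1/KERNEL-CHEAP-REPLAY-SPEC.md §1 (term list), §9 (I)] -/
structure TermPresD (m : ℕ) where
  /-- mantissa bits of the derived boxes -/
  prec : ℕ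
  /-- window width -/
  W : ℕ
  /-- number of flat window coordinates -/
  n : ℕ
  /-- flat numbering of (mode, window shell) -/
  eN : Fin m → ℕ → ℕ
  /-- its inverse: flat index ↦ (mode, shell) -/
  dN : ℕ → ℕ × ℕ
  /-- per output mode: the (i₁, i₂, μ) with a nonzero table entry -/
  supp : Fin m → List (Fin m × Fin m × ShiftIdx)
  /-- rational part of `α i₁ i₂ i μ` -/
  qcoef : Fin m → Fin m → Fin m → ShiftIdx → ℚ
  /-- `Λ`-exponent of `α i₁ i₂ i μ` -/
  apow : Fin m → Fin m → Fin m → ShiftIdx → ℤ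
  /-- the scale parameter `ε₀` -/
  epsQ : ℚ
  /-- box of `Λ = (1+ε₀)^{5/2}` -/
  lam : IntervalD
  /-- box of `Λ⁻¹` -/
  lamInv : IntervalD
  /-- tube centre boxes of the tail shells -/
  cen : Fin m → ℤ → IntervalD
  /-- tube radii bounds of the tail shells -/
  rad : ℤ → Dyad

namespace TermPresD

variable {m : ℕ} (P : TermPresD m)

/-- `Λ^p` for `p ∈ ℤ` (powers of the `Λ` box resp. the `Λ⁻¹` box). [folklore] -/
def lamPow (p : ℤ) : IntervalD :=
  if 0 ≤ p then IntervalD.powR P.prec P.lam p.toNat else IntervalD.powR P.prec P.lamInv (-p).toNat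

/-- Coefficient box of the term `(i₁, i₂, μ)` in output `(i, j)`: `q · Λ^{a + j − μ₃}`. [cite: Tao2016AveragedNS, §4 (4.8) (the clock (1+ε₀)^{5(n−μ₃)/2})] -/
def coefBox (i : Fin m) (j : ℕ) (i₁ i₂ : Fin m) (μ : ShiftIdx) : IntervalD :=
  IntervalD.mulR P.prec (IntervalD.ofRat P.prec (P.qcoef i₁ i₂ i μ)) (P.lamPow (P.apow i₁ i₂ i μ + (j : ℤ) - μ.1.2.2))

/-- Data factor of the lattice site `(i₁, k)`: flat coordinate on the window, tube box off it. [folklore] -/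
def facD (i₁ : Fin m) (k : ℤ) : RFac :=
  if 0 ≤ k ∧ k < P.W then RFac.coord (P.eN i₁ k.toNat) else RFac.ext (P.cen i₁ k) (P.rad k)

/-- Data of the term `q = (i₁, i₂, μ)` in output `(i, j)`. [folklore] -/
def termD (i : Fin m) (j : ℕ) (q : Fin m × Fin m × ShiftIdx) : RTermD :=
  (P.coefBox i j q.1 q.2.1 q.2.2, P.facD q.1 ((j : ℤ) - q.2.2.1.2.2 + q.2.2.1.1),
    P.facD q.2.1 ((j : ℤ) - q.2.2.1.2.2 + q.2.2.1.2.1))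

/-- The data row of output `(i, j)`. [folklore] -/
def rowD (i : Fin m) (j : ℕ) : List RTermD := (P.supp i).map (P.termD i j)

/-- **The term data of the window field** (row `c` = output `dN c`). [cite: Tao2016AveragedNS, §4 (4.8); cell vocabulary, harvest/h2-tao-ladder rung1/KERNEL-CHEAP-REPLAY-SPEC.md §8 (TERM DATA)] -/
def mkRD : RRows :=
  Array.ofFn fun c : Fin P.n => if h : (P.dN c).1 < m then P.rowD ⟨(P.dN c).1, h⟩ (P.dN c).2 else []

/-- The square certificates of the `Λ` / `Λ⁻¹` boxes (exact rational arithmetic). [folklore] -/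
def check : Bool :=
  decide (0 < 1 + P.epsQ ∧ 0 ≤ Dyad.toRat P.lam.lo ∧ 0 ≤ Dyad.toRat P.lam.hi ∧
    Dyad.toRat P.lam.lo ^ 2 ≤ (1 + P.epsQ) ^ 5 ∧ (1 + P.epsQ) ^ 5 ≤ Dyad.toRat P.lam.hi ^ 2 ∧
    0 ≤ Dyad.toRat P.lamInv.lo ∧ Dyad.toRat P.lamInv.lo * Dyad.toRat P.lam.hi ≤ 1 ∧
    1 ≤ Dyad.toRat P.lamInv.hi * Dyad.toRat P.lam.lo)

/-! ### What the instance proves about its frame -/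

/-- **The presentation matches the frame**: window width; numbering values and inverse; `ε₀`; the table is
`qcoef · Λ^apow` and vanishes off the support lists (no duplicates); tube centres in `cen`, tube radii below `rad`.
[cite: Tao2016AveragedNS, §4 (4.1), (4.8); cell vocabulary, harvest/h2-tao-ladder rung1/KERNEL-CHEAP-REPLAY-SPEC.md §9 (I)] -/
structure Frames (F : OneShiftFrame m) (ε₀ : ℝ) (α : Fin m → Fin m → Fin m → ℤ × ℤ × ℤ → ℝ)
    (e : F.SIdx ≃ Fin P.n) : Prop where
  hW : P.W = F.W
  heN : ∀ (i : Fin m) (j : Fin F.W), (e (i, j) : ℕ) = P.eN i j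
  hdN : ∀ (i : Fin m) (j : Fin F.W), P.dN (P.eN i j) = ((i : ℕ), (j : ℕ))
  hε : ε₀ = (P.epsQ : ℝ)
  hα : ∀ (i₁ i₂ i : Fin m) (μ : ShiftIdx),
    α i₁ i₂ i μ = (P.qcoef i₁ i₂ i μ : ℝ) * bigLam ε₀ ^ P.apow i₁ i₂ i μ
  hsupp : ∀ (i i₁ i₂ : Fin m) (μ : ShiftIdx), (i₁, i₂, μ) ∉ P.supp i → α i₁ i₂ i μ = 0
  hnodup : ∀ i, (P.supp i).Nodup
  hcen : ∀ i k, ¬ F.InWindow k → IntervalD.mem (F.tubeC i k) (P.cen i k)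
  hrad : ∀ k, ¬ F.InWindow k → F.tubeR k ≤ (P.rad k).toReal

/-- The centre term list: the window field's terms with every tail frozen at its tube centre. [cite: Tao2016AveragedNS, §4 (4.8); cell vocabulary, harvest/h2-tao-ladder rung1/KERNEL-CHEAP-REPLAY-SPEC.md §8 (centre list `Tc`)] -/
def centreList (F : OneShiftFrame m) (ε₀ : ℝ) (α : Fin m → Fin m → Fin m → ℤ × ℤ × ℤ → ℝ) :
    F.TIdx → BTerm F.SIdx :=
  F.wterms ε₀ α (fun i k _ => F.tubeC i k) 0

/-- The row lists: output `o` ↦ the terms `(o, q)`, `q ∈ supp o.1`. [folklore] -/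
def rowsOf (F : OneShiftFrame m) (o : F.SIdx) : List F.TIdx := (P.supp o.1).map fun q => (o, q)

/-! ### Soundness -/

section Sound

variable {P}
variable {F : OneShiftFrame m} {ε₀ : ℝ} {α : Fin m → Fin m → Fin m → ℤ × ℤ × ℤ → ℝ} {e : F.SIdx ≃ Fin P.n}

/-- The gain `(1+ε₀)^{5p/2}` is `Λ^p`. [cite: Tao2016AveragedNS, §4 (4.8)] -/
theorem rpow_gain (hε : 0 < 1 + ε₀) (p : ℤ) : (1 + ε₀) ^ ((5 : ℝ) * (p : ℝ) / 2) = bigLam ε₀ ^ p := by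
  rw [bigLam, ← Real.rpow_intCast, ← Real.rpow_mul hε.le]
  congr 1; ring

/-- `Λ ∈ lam` and `Λ⁻¹ ∈ lamInv` from the square certificates. [folklore] -/
theorem mem_lam (hchk : P.check = true) (hε : ε₀ = (P.epsQ : ℝ)) :
    IntervalD.mem (bigLam ε₀) P.lam ∧ IntervalD.mem (bigLam ε₀)⁻¹ P.lamInv ∧ 0 < bigLam ε₀ := by
  unfold check at hchk
  rw [decide_eq_true_eq] at hchk
  obtain ⟨h0, hlo0, hhi0, hlo, hhi, hu0, hu, hv⟩ := hchk
  have hε' : 0 < 1 + ε₀ := by rw [hε]; exact_mod_cast h0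
  have hΛ : 0 < bigLam ε₀ := Real.rpow_pos_of_pos hε' _
  have hΛsq : bigLam ε₀ ^ 2 = (((1 + P.epsQ) ^ 5 : ℚ) : ℝ) := by
    push_cast
    rw [← hε, bigLam, ← Real.rpow_natCast, ← Real.rpow_mul hε'.le]
    norm_num
  have cast_le : ∀ {a b : ℚ}, a ≤ b → ((a : ℚ) : ℝ) ≤ b := fun h => by exact_mod_cast h
  have hlo' : P.lam.lo.toReal ≤ bigLam ε₀ := by
    have h1 : P.lam.lo.toReal ^ 2 ≤ bigLam ε₀ ^ 2 := by
      rw [hΛsq, ← Dyad.cast_toRat]; exact_mod_cast hlo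
    have h2 : 0 ≤ P.lam.lo.toReal := by rw [← Dyad.cast_toRat]; exact_mod_cast hlo0
    nlinarith
  have hhi' : bigLam ε₀ ≤ P.lam.hi.toReal := by
    have h1 : bigLam ε₀ ^ 2 ≤ P.lam.hi.toReal ^ 2 := by
      rw [hΛsq, ← Dyad.cast_toRat]; exact_mod_cast hhi
    have h2 : 0 ≤ P.lam.hi.toReal := by rw [← Dyad.cast_toRat]; exact_mod_cast hhi0
    nlinarith
  refine ⟨⟨hlo', hhi'⟩, ⟨?_, ?_⟩, hΛ⟩
  · -- u ≤ Λ⁻¹ from u · hi ≤ 1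
    have hu' : P.lamInv.lo.toReal * P.lam.hi.toReal ≤ 1 := by
      rw [← Dyad.cast_toRat, ← Dyad.cast_toRat]; exact_mod_cast hu
    have hu0' : 0 ≤ P.lamInv.lo.toReal := by rw [← Dyad.cast_toRat]; exact_mod_cast hu0
    rw [inv_eq_one_div, le_div_iff₀ hΛ]
    nlinarith [mul_le_mul_of_nonneg_left hhi' hu0']
  · -- Λ⁻¹ ≤ v from 1 ≤ v · lo
    have hv' : 1 ≤ P.lamInv.hi.toReal * P.lam.lo.toReal := by
      rw [← Dyad.cast_toRat, ← Dyad.cast_toRat]; exact_mod_cast hv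
    have hlo0' : 0 ≤ P.lam.lo.toReal := by rw [← Dyad.cast_toRat]; exact_mod_cast hlo0
    have hvpos : 0 ≤ P.lamInv.hi.toReal := by nlinarith
    rw [inv_eq_one_div, div_le_iff₀ hΛ]
    nlinarith [mul_le_mul_of_nonneg_left hlo' hvpos]

/-- `Λ^p ∈ lamPow p` for every `p ∈ ℤ`. [folklore] -/
theorem mem_lamPow (hchk : P.check = true) (hε : ε₀ = (P.epsQ : ℝ)) (p : ℤ) :
    IntervalD.mem (bigLam ε₀ ^ p) (P.lamPow p) := by
  obtain ⟨hl, hli, hΛ⟩ := mem_lam hchk hε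
  unfold lamPow
  split_ifs with hp
  · have : bigLam ε₀ ^ p = bigLam ε₀ ^ p.toNat := by
      rw [← zpow_natCast, Int.toNat_of_nonneg hp]
    rw [this]; exact IntervalD.mem_powR P.prec hl _
  · have : bigLam ε₀ ^ p = (bigLam ε₀)⁻¹ ^ (-p).toNat := by
      rw [inv_pow, ← zpow_natCast, Int.toNat_of_nonneg (by omega), zpow_neg, inv_inv]
    rw [this]; exact IntervalD.mem_powR P.prec hli _

/-- The coefficient of a term of `wterms` lies in its box. [cite: Tao2016AveragedNS, §4 (4.8)] -/
theorem mem_coefBox (S : P.Frames F ε₀ α e) (hchk : P.check = true) (i : Fin m) (j : Fin F.W)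
    (i₁ i₂ : Fin m) (μ : ShiftIdx) :
    IntervalD.mem (α i₁ i₂ i μ * (1 + ε₀) ^ ((5 : ℝ) * (((j : ℕ) : ℤ) - μ.1.2.2) / 2))
      (P.coefBox i j i₁ i₂ μ) := by
  have h0 : 0 < 1 + P.epsQ := by
    unfold check at hchk; rw [decide_eq_true_eq] at hchk; exact hchk.1
  have hε' : 0 < 1 + ε₀ := by rw [S.hε]; exact_mod_cast h0
  have hΛ := (mem_lam hchk S.hε).2.2
  have ecast : ((((j : ℕ) : ℤ) : ℝ) - (μ.1.2.2 : ℝ)) = (((((j : ℕ) : ℤ) - μ.1.2.2 : ℤ)) : ℝ) := by push_cast; ring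
  rw [ecast, rpow_gain hε', S.hα, mul_assoc, ← zpow_add₀ hΛ.ne']
  unfold coefBox
  have e1 : P.apow i₁ i₂ i μ + (((j : ℕ) : ℤ) - μ.1.2.2) = P.apow i₁ i₂ i μ + (j : ℤ) - μ.1.2.2 := by ring
  rw [e1]
  exact IntervalD.mem_mulR P.prec (IntervalD.mem_ofRat P.prec _) (mem_lamPow hchk S.hε _)

/-- The data factor matches the centre factor (tail at the tube centre) and the rough factor (tail in the tube).
[cite: Tao2016AveragedNS, §4 (4.8); cell vocabulary, harvest/h2-tao-ladder rung1/KERNEL-CHEAP-REPLAY-SPEC.md §8 (TermOK)] -/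
theorem facOK_factorAt (S : P.Frames F ε₀ α e) {T : Fin m → ℤ → ℝ → ℝ} {t : ℝ}
    (hT : ∀ i k, ¬ F.InWindow k → |T i k t - F.tubeC i k| ≤ F.tubeR k) (i₁ : Fin m) (k : ℤ) :
    FacOK e (P.facD i₁ k) (F.factorAt (fun i k _ => F.tubeC i k) 0 i₁ k) (F.factorAt T t i₁ k) := by
  unfold facD OneShiftFrame.factorAt
  by_cases hk : F.InWindow k
  · have hk' : 0 ≤ k ∧ k < P.W := by rw [S.hW]; exact hk
    rw [if_pos hk', dif_pos hk, dif_pos hk]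
    refine ⟨(i₁, F.widx hk), ?_, rfl, rfl⟩
    rw [S.heN]; rfl
  · have hk' : ¬ (0 ≤ k ∧ k < P.W) := by rw [S.hW]; exact hk
    rw [if_neg hk', dif_neg hk, dif_neg hk]
    exact ⟨F.tubeC i₁ k, T i₁ k t, rfl, rfl, S.hcen i₁ k hk, (F.tubeR_nonneg k).trans (S.hrad k hk),
      (hT i₁ k hk).trans (S.hrad k hk)⟩

/-- Every listed term is matched by its data. [folklore] -/
theorem termOK_termD (S : P.Frames F ε₀ α e) (hchk : P.check = true) {T : Fin m → ℤ → ℝ → ℝ} {t : ℝ}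
    (hT : ∀ i k, ¬ F.InWindow k → |T i k t - F.tubeC i k| ≤ F.tubeR k) (o : F.SIdx)
    (q : Fin m × Fin m × ShiftIdx) :
    TermOK e (P.termD o.1 o.2 q) (centreList F ε₀ α (o, q)) (F.wterms ε₀ α T t (o, q)) := by
  refine ⟨?_, rfl, ?_, ?_⟩
  · exact mem_coefBox S hchk o.1 o.2 q.1 q.2.1 q.2.2
  · exact facOK_factorAt S hT q.1 _
  · exact facOK_factorAt S hT q.2.1 _

/-- The data row of an output is `rowD`. [folklore] -/
theorem rrow_mkRD (S : P.Frames F ε₀ α e) (o : F.SIdx) : rrow P.mkRD (e o) = P.rowD o.1 o.2 := by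
  have hlt : (e o : ℕ) < P.n := (e o).isLt
  unfold rrow mkRD
  rw [dif_pos (by rw [Array.size_ofFn]; exact hlt), Array.getElem_ofFn]
  rcases o with ⟨i, j⟩
  simp only [S.heN, S.hdN, Fin.is_lt, dif_pos, Fin.eta]

/-- **ROW ENUMERATION for the window field's term list**: with complete, duplicate-free support lists, every
coefficient-weighted sum over the term index restricted to one output is the list sum over `rowsOf`.
[cite: Tao2016AveragedNS, §4 (4.8); cell vocabulary, harvest/h2-tao-ladder rung1/KERNEL-CHEAP-REPLAY-SPEC.md §8 (RowEnum)] -/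
theorem rowEnum_wterms (S : P.Frames F ε₀ α e) (T : Fin m → ℤ → ℝ → ℝ) (t : ℝ) :
    RowEnum (F.wterms ε₀ α T t) (P.rowsOf F) := by
  classical
  intro o g
  have hnodup : (P.rowsOf F o).Nodup :=
    (S.hnodup o.1).map (Prod.mk_right_injective o)
  -- off the row list the summand vanishes
  have hzero : ∀ k ∈ (Finset.univ : Finset F.TIdx), k ∉ (P.rowsOf F o).toFinset →
      (F.wterms ε₀ α T t k).coefAt o * g k = 0 := by
    intro k _ hk
    by_cases ho : k.1 = o
    · have hns : k.2 ∉ P.supp o.1 := by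
        intro hmem
        apply hk
        rw [List.mem_toFinset]
        unfold rowsOf
        rw [List.mem_map]
        exact ⟨k.2, hmem, by rw [← ho]⟩
      have hα0 := S.hsupp o.1 k.2.1 k.2.2.1 k.2.2.2 hns
      simp only [BTerm.coefAt, OneShiftFrame.wterms, ho, if_true]
      rw [show k.2.1 = k.2.1 from rfl, hα0, zero_mul, zero_mul]
    · simp only [BTerm.coefAt, OneShiftFrame.wterms, ho, if_false, zero_mul]
  rw [← Finset.sum_subset (Finset.subset_univ (P.rowsOf F o).toFinset) hzero, List.sum_toFinset _ hnodup]
  congr 1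
  refine List.map_congr_left fun k hk => ?_
  have ho : k.1 = o := by
    unfold rowsOf at hk
    rw [List.mem_map] at hk
    obtain ⟨q, _, rfl⟩ := hk
    rfl
  simp only [BTerm.coefAt, OneShiftFrame.wterms, ho, if_true]

/-- **THE TERM DATA PRESENTS THE WINDOW FIELD** (the real-side obligation of the instance, SPEC §8): for every tail
realisation `T` in the tubes at time `t`, `IsRTEncl e Tc (wterms T t) rows mkRD` with the centre list `Tc` (tails at
the tube centres) and the rows `rowsOf`. [cite: Tao2016AveragedNS, §4 (4.8); Moore1979, §3.2; cell vocabulary, harvest/h2-tao-ladder rung1/KERNEL-CHEAP-REPLAY-SPEC.md §8/§9 (I)] -/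
theorem isRTEncl_wterms (S : P.Frames F ε₀ α e) (hchk : P.check = true) {T : Fin m → ℤ → ℝ → ℝ} {t : ℝ}
    (hT : ∀ i k, ¬ F.InWindow k → |T i k t - F.tubeC i k| ≤ F.tubeR k) :
    IsRTEncl e (centreList F ε₀ α) (F.wterms ε₀ α T t) (P.rowsOf F) P.mkRD := by
  refine ⟨rowEnum_wterms S _ _, fun k => ⟨rfl, rfl⟩, fun o => ?_⟩
  rw [rrow_mkRD S o]
  unfold rowD rowsOf
  rw [List.forall₂_map_left_iff, List.forall₂_map_right_iff, List.forall₂_same]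
  intro q _
  exact termOK_termD S hchk hT o q

/-- The centre list against itself. [folklore] -/
theorem isRTEncl_centre (S : P.Frames F ε₀ α e) (hchk : P.check = true) :
    IsRTEncl e (centreList F ε₀ α) (centreList F ε₀ α) (P.rowsOf F) P.mkRD :=
  isRTEncl_wterms S hchk fun i k _ => by
    show |F.tubeC i k - F.tubeC i k| ≤ F.tubeR k
    rw [sub_self, abs_zero]; exact F.tubeR_nonneg k

end Sound

end TermPresD

/-! ### Transport along numberings with equal values; the hypotheses of `K1_of_grid` -/

/-- `IsRTEncl` only sees the VALUES of the numbering. [folklore] -/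
theorem IsRTEncl.of_val_eq {ι : Type*} [Fintype ι] [DecidableEq ι] {κ : Type*} [Fintype κ] {n n' : ℕ}
    {e : ι ≃ Fin n} {e' : ι ≃ Fin n'} {Tc Tt : κ → BTerm ι} {rows : ι → List κ} {RD : RRows}
    (h : IsRTEncl e Tc Tt rows RD) (hee : ∀ i, (e' i : ℕ) = (e i : ℕ)) : IsRTEncl e' Tc Tt rows RD := by
  obtain ⟨h1, h2, h3⟩ := h
  refine ⟨h1, h2, fun i => ?_⟩
  rw [hee]
  refine (h3 i).imp fun d k hdk => ?_
  obtain ⟨hc, hs, ha, hb⟩ := hdk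
  have hfac : ∀ (r : RFac) (φ ψ : Factor ι), FacOK e r φ ψ → FacOK e' r φ ψ := by
    intro r φ ψ hr
    cases r with
    | coord c => obtain ⟨i', hi', h1, h2⟩ := hr; exact ⟨i', by rw [hee]; exact hi', h1, h2⟩
    | ext cen rad => exact hr
  exact ⟨hc, hs, hfac _ _ _ ha, hfac _ _ _ hb⟩

namespace TermPresD

variable {m : ℕ} {P : TermPresD m}
variable {F : OneShiftFrame m} {ε₀ : ℝ} {α : Fin m → Fin m → Fin m → ℤ × ℤ × ℤ → ℝ}

/-- **Hypothesis `hRDc` of part XLVI `K1_of_grid`** for a grid all of whose steps carry `mkRD`. [cite: Tao2016AveragedNS, §4 (4.8); cell vocabulary, harvest/h2-tao-ladder rung1/KERNEL-CHEAP-REPLAY-SPEC.md §9 (I)] -/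
theorem hRDc_of_frames {g : GridD} {e : F.SIdx ≃ Fin g.n} (hn : ∀ s, (g.step s).n = g.n) (hPn : P.n = g.n)
    (S : P.Frames F ε₀ α (e.trans (finCongr hPn.symm))) (hchk : P.check = true)
    (hRD : ∀ s ≤ g.S, (g.step s).RD = P.mkRD) :
    ∀ s ≤ g.S, IsRTEncl (g.es e hn s) (centreList F ε₀ α) (centreList F ε₀ α) (P.rowsOf F) (g.step s).RD := by
  intro s hs
  rw [hRD s hs]
  exact IsRTEncl.of_val_eq (isRTEncl_centre S hchk) fun i => by simp

/-- **Hypothesis `hRD` of part XLVI `K1_of_grid`**: the realisation `wterms (preclampTail u) t` of every point of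
trajectory space is presented on every step at every time (pre-clamped tails lie in the tubes at ALL times).
[cite: Tao2016AveragedNS, §4 (4.8); cell vocabulary, harvest/h2-tao-ladder rung1/KERNEL-CHEAP-REPLAY-SPEC.md §9 (I)] -/
theorem hRD_of_frames {g : GridD} {e : F.SIdx ≃ Fin g.n} (hn : ∀ s, (g.step s).n = g.n) (hPn : P.n = g.n)
    (S : P.Frames F ε₀ α (e.trans (finCongr hPn.symm))) (hchk : P.check = true)
    (hRD : ∀ s ≤ g.S, (g.step s).RD = P.mkRD) (R : ℤ → ℝ) :
    ∀ u, F.AdmLip R u → ∀ s ≤ g.S, ∀ r ∈ Ico 0 (g.h s).toReal,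
      IsRTEncl (g.es e hn s) (centreList F ε₀ α) (F.wterms ε₀ α (F.preclampTail u) (g.t s + r)) (P.rowsOf F)
        (g.step s).RD := by
  intro u _ s hs r _
  rw [hRD s hs]
  refine IsRTEncl.of_val_eq (isRTEncl_wterms S hchk fun i k hk => ?_) fun i => by simp
  -- pre-clamped tails lie in the tubes at every time
  unfold OneShiftFrame.preclampTail OneShiftFrame.clampTail
  rw [if_neg hk]
  have hw := F.wt_pos k
  set x := (u.2.2 : F.TailIdx → ℝ) (i, k, projIcc 0 F.τhi F.τhi_pos.le (g.t s + r)) with hx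
  have hlo : (F.tubeC i k - F.tubeR k) / F.wt k ≤ max ((F.tubeC i k - F.tubeR k) / F.wt k)
      (min ((F.tubeC i k + F.tubeR k) / F.wt k) x) := le_max_left _ _
  have hhi : max ((F.tubeC i k - F.tubeR k) / F.wt k) (min ((F.tubeC i k + F.tubeR k) / F.wt k) x) ≤
      (F.tubeC i k + F.tubeR k) / F.wt k :=
    max_le (by gcongr; linarith [F.tubeR_nonneg k]) (min_le_left _ _)
  rw [abs_le]
  rw [div_le_iff₀ hw] at hlo
  rw [le_div_iff₀ hw] at hhi
  constructor <;> nlinarith [hlo, hhi]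

/-- **Hypothesis `hTf` of part XLVI `K1_of_grid`** for the realisation `wterms (preclampTail u) t` (part XIX).
[folklore] -/
theorem hTf_wterms (R : ℤ → ℝ) : ∀ u, F.AdmLip R u → ∀ t x,
    termField (F.wterms ε₀ α (F.preclampTail u) t) x = F.wfieldFlat ε₀ α (F.preclampTail u) t x :=
  fun u _ t x => by rw [F.wfieldFlat_eq_termField]

end TermPresD


end DSSOneShift

end Summit.NavierStokesRegularity.NavierStokesRegularity.Theorems
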